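import Mathlib
import Summits.Ventures.PercRepro2.Defs
import Summits.Ventures.PercRepro2.Independence
import Summits.Ventures.PercRepro2.Harris
import Summits.Ventures.PercRepro2.ObsIndependence
import Summits.Ventures.PercRepro2.CoinDefs
import Summits.Ventures.PercRepro2.CoinArcsOff
import Summits.Ventures.PercRepro2.CoinPendantDefs
import Summits.Ventures.PercRepro2.CoinPendant
import Summits.Ventures.PercRepro2.CoinPathDefs
import Summits.Ventures.PercRepro2.CoinInduced
import Summits.Ventures.PercRepro2.CoinFrontier
import Summits.Ventures.PercRepro2.CoinVdBK
import Summits.Ventures.PercRepro2.CoinBHK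
import Summits.Ventures.PercRepro2.CoinReverse
import Summits.Ventures.PercRepro2.CoinLemmaA
import Summits.Ventures.PercRepro2.CoinDarcMixed
import Summits.Ventures.PercRepro2.CoinTwoPendantDefs

/-!
# Mass decomposition over the four levels of a two-vertex pendant head (blind cell PercRepro2,
night-2 g3; proofs/NIGHT2-DARC.md §16)

Let `P = {w, v}` (`w ≠ v`) be closed out into the single target `t` (`ClosedOut`), its out-coins
carrying only arcs with tails in `P ∪ {t}` (`TailCoinsIn`), and `D₀ = arcsOff arcs (P ∪ {t})`.
`avoid_eq_levels` / `gate_eq_levels` (`CoinTwoPendantDefs.lean`) split `R_T` and the gate event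
of an arc `u → w` over the four LEVELS `lvl₀ … lvl₃` (which of `w`, `v` reach `t`).  Here:
* the level events depend on the pendant coins only and the reduced events / markers on the other
  coins, so every mass FACTORISES (`twoPendant_piece`, `twoPendant_mass`):
  `E[g; R_T] = Σ_i ℓ_i · E[f; R_i]`, `E[g; gate] = Σ_i ℓ_i · E[f; R_i^E]` for `g = f` on `R_T`,
  `ℓ_i = P(lvl_i)`, `R_i` the reduced avoidance events (`R_2^E, R_3^E` with `u` added);
* the trace functionals `g(K⁻ ∩ P)` are constant on the levels, so
  `E[g(K⁻ ∩ P); R_T] = Σ_Z g(Z)·ℓ_Z·P_Z` (`twoPendant_tower`), and likewise over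
  `R_T ∩ {w ∉ K⁻}` with the two `w`-free traces.
Used by `CoinTwoPendant.lean` (the theorem `darc_of_twoPendant_mixed`).
-/

namespace Summit.Ventures.PercRepro2.Coin

section Tools

open Classical

variable {E : Type*} [Fintype E] [DecidableEq E] {R : Type*} [CommRing R]

/-- The mass of a constant: `E[c; 𝒟] = c · P(𝒟)`. -/
lemma massE_const (p : E → R) (c : R) (D : Set (Config E)) :
    massE p (fun _ => c) D = c * prob p D := by
  unfold massE expect prob
  rw [Finset.mul_sum]
  refine Finset.sum_congr rfl fun ω _ => ?_
  by_cases h : ω ∈ D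
  · simp [Set.indicator_of_mem h, mul_comm]
  · simp [Set.indicator_of_notMem h]

/-- `expect p (g · 1_𝒟) = E[g; 𝒟]`. -/
lemma expect_mul_indicator_one (p : E → R) (g : Config E → R) (D : Set (Config E)) :
    expect p (g * D.indicator 1) = massE p g D := by
  unfold massE
  congr 1
  ext ω
  by_cases h : ω ∈ D
  · simp [Set.indicator_of_mem h]
  · simp [Set.indicator_of_notMem h]

end Tools

section TwoPendant

open Classical

variable {V : Type*} {E : Type*} [DecidableEq V] [Fintype E] [DecidableEq E] {R : Type*} [Field R]

/-- The factorisation of a mass over a level piece: for a level event `L` depending on the pendant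
coins and an integrand depending on the other coins, `E[g; L ∩ R^{D₀}_X] = P(L) · E[f; R^{D₀}_X]`
whenever `g = f` on the piece. -/
lemma twoPendant_piece (p : E → R) {arcs : E → Finset (V × V)} {w v t : V}
    (hT : TailCoinsIn arcs {w, v} {t}) {L : Set (Config E)}
    (hL : DependsOn (· ∈ L) (tailCoins arcs {w, v})) (s : V) (X : Finset V)
    {f g : Config E → R} (hf : DependsOn f (tailCoins arcs {w, v})ᶜ)
    (hg : ∀ ω ∈ L ∩ avoidEvent (arcsOff arcs ({w, v} ∪ {t})) s X, g ω = f ω) :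
    massE p g (L ∩ avoidEvent (arcsOff arcs ({w, v} ∪ {t})) s X) =
      prob p L * massE p f (avoidEvent (arcsOff arcs ({w, v} ∪ {t})) s X) := by
  set F : Set E := tailCoins arcs {w, v} with hF
  set D₀ := arcsOff arcs ({w, v} ∪ {t}) with hD₀
  have hcongr : ∀ ω ω' : Config E, (∀ e ∈ Fᶜ, ω e = ω' e) → ∀ e, D₀ e ≠ ∅ → ω e = ω' e := by
    intro ω ω' h e he
    by_cases hmem : e ∈ F
    · exact absurd (arcsOff_eq_empty_of_tailCoins hT hmem) he
    · exact h e hmem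
  have hdep : DependsOn ((avoidEvent D₀ s X).indicator f) Fᶜ := by
    intro ω ω' h
    have hreach : ∀ x y, Reach D₀ ω x y ↔ Reach D₀ ω' x y :=
      fun x y => reach_arcsOff_congr (hcongr ω ω' h)
    have hmem : ω ∈ avoidEvent D₀ s X ↔ ω' ∈ avoidEvent D₀ s X := by
      simp only [avoidEvent, Set.mem_setOf_eq, hreach]
    by_cases hω : ω ∈ avoidEvent D₀ s X
    · rw [Set.indicator_of_mem hω, Set.indicator_of_mem (hmem.mp hω)]; exact hf h
    · rw [Set.indicator_of_notMem hω, Set.indicator_of_notMem (fun h' => hω (hmem.mpr h'))]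
  rw [massE_congr' p hg]
  exact massE_inter_of_dependsOn' p F L hL f _ hdep

omit [Fintype E] [DecidableEq E] in
/-- The reduced markers depend on the non-pendant coins. -/
lemma twoPendant_dependsOn_marker {arcs : E → Finset (V × V)} {w v t : V}
    (hT : TailCoinsIn arcs {w, v} {t}) (s a : V) :
    DependsOn (marker (R := R) (arcsOff arcs ({w, v} ∪ {t})) s a) (tailCoins arcs {w, v})ᶜ := by
  intro ω ω' h
  have hcongr : ∀ e, arcsOff arcs ({w, v} ∪ {t}) e ≠ ∅ → ω e = ω' e := by
    intro e he
    by_cases hmem : e ∈ tailCoins arcs {w, v}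
    · exact absurd (arcsOff_eq_empty_of_tailCoins hT hmem) he
    · exact h e hmem
  have hr : Reach (arcsOff arcs ({w, v} ∪ {t})) ω s a ↔
      Reach (arcsOff arcs ({w, v} ∪ {t})) ω' s a := reach_arcsOff_congr hcongr
  simp only [marker, hr]

omit [Fintype E] [DecidableEq E] in
/-- The four level events depend on the pendant coins. -/
lemma twoPendant_dependsOn_levels {arcs : E → Finset (V × V)} {w v t : V}
    (hclosed : ClosedOut arcs {w, v} {t}) :
    DependsOn (· ∈ lvl₀ arcs {t} w v) (tailCoins arcs {w, v}) ∧
    DependsOn (· ∈ lvl₁ arcs {t} w v) (tailCoins arcs {w, v}) ∧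
    DependsOn (· ∈ lvl₂ arcs {t} w v) (tailCoins arcs {w, v}) ∧
    DependsOn (· ∈ lvl₃ arcs {t} w v) (tailCoins arcs {w, v}) := by
  have hbw : DependsOn (· ∈ bwdEvent arcs w {t}) (tailCoins arcs {w, v}) :=
    dependsOn_bwdEvent_pendant arcs hclosed (by simp)
  have hbv : DependsOn (· ∈ bwdEvent arcs v {t}) (tailCoins arcs {w, v}) :=
    dependsOn_bwdEvent_pendant arcs hclosed (by simp)
  refine ⟨?_, ?_, ?_, ?_⟩
  · unfold lvl₀
    have := dependsOn_inter (dependsOn_compl hbw) (dependsOn_compl hbv)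
    rwa [Set.union_self] at this
  · unfold lvl₁
    have := dependsOn_inter (dependsOn_compl hbw) hbv
    rwa [Set.union_self] at this
  · unfold lvl₂
    have := dependsOn_inter hbw (dependsOn_compl hbv)
    rwa [Set.union_self] at this
  · unfold lvl₃
    have := dependsOn_inter hbw hbv
    rwa [Set.union_self] at this

omit [Fintype E] [DecidableEq E] in
/-- The levels are pairwise disjoint (as needed for the two unions). -/
lemma twoPendant_disjoint {arcs : E → Finset (V × V)} {w v t : V} (s : V)
    (X₀ X₁ X₂ X₃ : Finset V) :
    Disjoint (lvl₀ arcs {t} w v ∩ avoidEvent (arcsOff arcs ({w, v} ∪ {t})) s X₀)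
        (lvl₁ arcs {t} w v ∩ avoidEvent (arcsOff arcs ({w, v} ∪ {t})) s X₁) ∧
    Disjoint (lvl₂ arcs {t} w v ∩ avoidEvent (arcsOff arcs ({w, v} ∪ {t})) s X₂)
        (lvl₃ arcs {t} w v ∩ avoidEvent (arcsOff arcs ({w, v} ∪ {t})) s X₃) ∧
    Disjoint (lvl₀ arcs {t} w v ∩ avoidEvent (arcsOff arcs ({w, v} ∪ {t})) s X₀ ∪
        lvl₁ arcs {t} w v ∩ avoidEvent (arcsOff arcs ({w, v} ∪ {t})) s X₁)
      (lvl₂ arcs {t} w v ∩ avoidEvent (arcsOff arcs ({w, v} ∪ {t})) s X₂ ∪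
        lvl₃ arcs {t} w v ∩ avoidEvent (arcsOff arcs ({w, v} ∪ {t})) s X₃) := by
  refine ⟨?_, ?_, ?_⟩
  · exact Set.disjoint_left.2 fun ω h₁ h₂ => h₁.1.2 h₂.1.2
  · exact Set.disjoint_left.2 fun ω h₁ h₂ => h₁.1.2 h₂.1.2
  · refine Set.disjoint_left.2 fun ω h₁ h₂ => ?_
    rcases (Set.mem_union _ _ _).mp h₁ with h₁ | h₁ <;>
      rcases (Set.mem_union _ _ _).mp h₂ with h₂ | h₂
    · exact h₁.1.1 h₂.1.1
    · exact h₁.1.1 h₂.1.1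
    · exact h₁.1.1 h₂.1.1
    · exact h₁.1.1 h₂.1.1

/-- **The mass decomposition over the four levels**: for `f` depending on the non-pendant coins
and `g = f` on `R_T`, `E[g; R_T] = Σ_i ℓ_i · E[f; R_i]` and `E[g; gate] = Σ_i ℓ_i · E[f; R_i^E]`. -/
lemma twoPendant_mass (p : E → R) {arcs : E → Finset (V × V)} {w v t : V}
    (hclosed : ClosedOut arcs {w, v} {t}) (hT : TailCoinsIn arcs {w, v} {t}) (hwv : w ≠ v)
    (s : V) {u : V} (hu : u ∉ ({w, v} : Finset V) ∪ {t}) {f g : Config E → R}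
    (hf : DependsOn f (tailCoins arcs {w, v})ᶜ) (hg : ∀ ω ∈ avoidEvent arcs s {t}, g ω = f ω) :
    massE p g (avoidEvent arcs s {t}) =
      prob p (lvl₀ arcs {t} w v) * massE p f (avoidEvent (arcsOff arcs ({w, v} ∪ {t})) s {t})
      + prob p (lvl₁ arcs {t} w v) *
          massE p f (avoidEvent (arcsOff arcs ({w, v} ∪ {t})) s (insert v {t}))
      + prob p (lvl₂ arcs {t} w v) *
          massE p f (avoidEvent (arcsOff arcs ({w, v} ∪ {t})) s (insert w {t}))
      + prob p (lvl₃ arcs {t} w v) *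
          massE p f (avoidEvent (arcsOff arcs ({w, v} ∪ {t})) s (insert w (insert v {t}))) ∧
    massE p g (gateEvent arcs s {t} u w) =
      prob p (lvl₀ arcs {t} w v) * massE p f (avoidEvent (arcsOff arcs ({w, v} ∪ {t})) s {t})
      + prob p (lvl₁ arcs {t} w v) *
          massE p f (avoidEvent (arcsOff arcs ({w, v} ∪ {t})) s (insert v {t}))
      + prob p (lvl₂ arcs {t} w v) *
          massE p f (avoidEvent (arcsOff arcs ({w, v} ∪ {t})) s (insert u (insert w {t})))
      + prob p (lvl₃ arcs {t} w v) *
          massE p f (avoidEvent (arcsOff arcs ({w, v} ∪ {t})) s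
            (insert u (insert w (insert v {t})))) := by
  obtain ⟨hL₀, hL₁, hL₂, hL₃⟩ := twoPendant_dependsOn_levels (t := t) hclosed
  have hRT := avoid_eq_levels (arcs := arcs) (T := {t}) hwv s
  have hG := gate_eq_levels (arcs := arcs) (T := {t}) hclosed hwv s hu
  -- every piece lies in `R_T`
  have hsubR : ∀ (L : Set (Config E)) (X : Finset V),
      L ∩ avoidEvent (arcsOff arcs ({w, v} ∪ {t})) s X ⊆ avoidEvent arcs s {t} →
      ∀ ω ∈ L ∩ avoidEvent (arcsOff arcs ({w, v} ∪ {t})) s X, g ω = f ω :=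
    fun L X hsub ω hω => hg ω (hsub hω)
  have hR₃₂ : avoidEvent (arcsOff arcs ({w, v} ∪ {t})) s (insert u (insert w (insert v {t}))) ⊆
      avoidEvent (arcsOff arcs ({w, v} ∪ {t})) s (insert w (insert v {t})) :=
    fun ω' h' t' ht' => h' t' (Finset.mem_insert_of_mem ht')
  have hR₂'₂ : avoidEvent (arcsOff arcs ({w, v} ∪ {t})) s (insert u (insert w {t})) ⊆
      avoidEvent (arcsOff arcs ({w, v} ∪ {t})) s (insert w {t}) :=
    fun ω' h' t' ht' => h' t' (Finset.mem_insert_of_mem ht')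
  have hs₀ : lvl₀ arcs {t} w v ∩ avoidEvent (arcsOff arcs ({w, v} ∪ {t})) s {t} ⊆
      avoidEvent arcs s {t} := by rw [hRT]; intro ω h; exact Or.inl (Or.inl h)
  have hs₁ : lvl₁ arcs {t} w v ∩ avoidEvent (arcsOff arcs ({w, v} ∪ {t})) s (insert v {t}) ⊆
      avoidEvent arcs s {t} := by rw [hRT]; intro ω h; exact Or.inl (Or.inr h)
  have hs₂ : lvl₂ arcs {t} w v ∩ avoidEvent (arcsOff arcs ({w, v} ∪ {t})) s (insert w {t}) ⊆
      avoidEvent arcs s {t} := by rw [hRT]; intro ω h; exact Or.inr (Or.inl h)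
  have hs₃ : lvl₃ arcs {t} w v ∩
      avoidEvent (arcsOff arcs ({w, v} ∪ {t})) s (insert w (insert v {t})) ⊆
      avoidEvent arcs s {t} := by rw [hRT]; intro ω h; exact Or.inr (Or.inr h)
  have hs₂' : lvl₂ arcs {t} w v ∩
      avoidEvent (arcsOff arcs ({w, v} ∪ {t})) s (insert u (insert w {t})) ⊆
      avoidEvent arcs s {t} := fun ω h => hs₂ ⟨h.1, hR₂'₂ h.2⟩
  have hs₃' : lvl₃ arcs {t} w v ∩
      avoidEvent (arcsOff arcs ({w, v} ∪ {t})) s (insert u (insert w (insert v {t}))) ⊆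
      avoidEvent arcs s {t} := fun ω h => hs₃ ⟨h.1, hR₃₂ h.2⟩
  constructor
  · obtain ⟨hd₀₁, hd₂₃, hd⟩ := twoPendant_disjoint (arcs := arcs) (w := w) (v := v) (t := t) s
      {t} (insert v {t}) (insert w {t}) (insert w (insert v {t}))
    rw [hRT, massE_union_of_disjoint p g hd, massE_union_of_disjoint p g hd₀₁,
      massE_union_of_disjoint p g hd₂₃,
      twoPendant_piece p hT hL₀ s _ hf (hsubR _ _ hs₀),
      twoPendant_piece p hT hL₁ s _ hf (hsubR _ _ hs₁),
      twoPendant_piece p hT hL₂ s _ hf (hsubR _ _ hs₂),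
      twoPendant_piece p hT hL₃ s _ hf (hsubR _ _ hs₃)]
    ring
  · obtain ⟨hd₀₁, hd₂₃, hd⟩ := twoPendant_disjoint (arcs := arcs) (w := w) (v := v) (t := t) s
      {t} (insert v {t}) (insert u (insert w {t})) (insert u (insert w (insert v {t})))
    rw [hG, massE_union_of_disjoint p g hd, massE_union_of_disjoint p g hd₀₁,
      massE_union_of_disjoint p g hd₂₃,
      twoPendant_piece p hT hL₀ s _ hf (hsubR _ _ hs₀),
      twoPendant_piece p hT hL₁ s _ hf (hsubR _ _ hs₁),
      twoPendant_piece p hT hL₂ s _ hf (hsubR _ _ hs₂'),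
      twoPendant_piece p hT hL₃ s _ hf (hsubR _ _ hs₃')]
    ring

/-- **The tower identity for trace functionals**: `E[g(K⁻ ∩ {w, v}); R_T] = Σ_Z g(Z)·ℓ_Z·P_Z`, and
the same over `R_T ∩ {w ∉ K⁻}` with the two `w`-free traces. -/
lemma twoPendant_tower (p : E → R) {arcs : E → Finset (V × V)} {w v t : V}
    (hclosed : ClosedOut arcs {w, v} {t}) (hT : TailCoinsIn arcs {w, v} {t}) (hwv : w ≠ v)
    (s : V) (g : Set V → R) :
    massE p (fun ω => g ({x | Reach arcs ω x t} ∩ ({w, v} : Set V))) (avoidEvent arcs s {t}) =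
      g ∅ * (prob p (lvl₀ arcs {t} w v) *
          prob p (avoidEvent (arcsOff arcs ({w, v} ∪ {t})) s {t}))
      + g {v} * (prob p (lvl₁ arcs {t} w v) *
          prob p (avoidEvent (arcsOff arcs ({w, v} ∪ {t})) s (insert v {t})))
      + g {w} * (prob p (lvl₂ arcs {t} w v) *
          prob p (avoidEvent (arcsOff arcs ({w, v} ∪ {t})) s (insert w {t})))
      + g {w, v} * (prob p (lvl₃ arcs {t} w v) *
          prob p (avoidEvent (arcsOff arcs ({w, v} ∪ {t})) s (insert w (insert v {t})))) ∧
    massE p (fun ω => g ({x | Reach arcs ω x t} ∩ ({w, v} : Set V)))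
        (avoidEvent arcs s {t} ∩ (bwdEvent arcs w {t})ᶜ) =
      g ∅ * (prob p (lvl₀ arcs {t} w v) *
          prob p (avoidEvent (arcsOff arcs ({w, v} ∪ {t})) s {t}))
      + g {v} * (prob p (lvl₁ arcs {t} w v) *
          prob p (avoidEvent (arcsOff arcs ({w, v} ∪ {t})) s (insert v {t}))) := by
  obtain ⟨hL₀, hL₁, hL₂, hL₃⟩ := twoPendant_dependsOn_levels (t := t) hclosed
  have hRT := avoid_eq_levels (arcs := arcs) (T := {t}) hwv s
  have hRw := avoid_inter_compl_eq_levels (arcs := arcs) (T := {t}) hwv s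
  have hconst : ∀ (c : R) (X : Finset V), DependsOn (fun _ : Config E => c)
      (tailCoins arcs {w, v})ᶜ := fun _ _ _ _ _ => rfl
  -- on each level the trace functional is the constant `g Z`
  have hpiece : ∀ (L : Set (Config E)) (hL : DependsOn (· ∈ L) (tailCoins arcs {w, v}))
      (X : Finset V) (c : R)
      (hc : ∀ ω ∈ L ∩ avoidEvent (arcsOff arcs ({w, v} ∪ {t})) s X,
        g ({x | Reach arcs ω x t} ∩ ({w, v} : Set V)) = c),
      massE p (fun ω => g ({x | Reach arcs ω x t} ∩ ({w, v} : Set V)))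
          (L ∩ avoidEvent (arcsOff arcs ({w, v} ∪ {t})) s X) =
        c * (prob p L * prob p (avoidEvent (arcsOff arcs ({w, v} ∪ {t})) s X)) := by
    intro L hL X c hc
    rw [twoPendant_piece p hT hL s X (hconst c X) hc, massE_const]
    ring
  have h₀ := hpiece _ hL₀ {t} (g ∅) fun ω hω => by rw [traceSet_lvl₀ hω.1]
  have h₁ := hpiece _ hL₁ (insert v {t}) (g {v}) fun ω hω => by rw [traceSet_lvl₁ hwv hω.1]
  have h₂ := hpiece _ hL₂ (insert w {t}) (g {w}) fun ω hω => by rw [traceSet_lvl₂ hwv hω.1]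
  have h₃ := hpiece _ hL₃ (insert w (insert v {t})) (g {w, v}) fun ω hω => by
    rw [traceSet_lvl₃ hω.1]
  obtain ⟨hd₀₁, hd₂₃, hd⟩ := twoPendant_disjoint (arcs := arcs) (w := w) (v := v) (t := t) s
    {t} (insert v {t}) (insert w {t}) (insert w (insert v {t}))
  constructor
  · rw [hRT, massE_union_of_disjoint p _ hd, massE_union_of_disjoint p _ hd₀₁,
      massE_union_of_disjoint p _ hd₂₃, h₀, h₁, h₂, h₃]
    ring
  · rw [hRw, massE_union_of_disjoint p _ hd₀₁, h₀, h₁]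

end TwoPendant

end Summit.Ventures.PercRepro2.Coin
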